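import Summits.Parity.GeneralizedHardyLittlewood.Theorems.PrimeLevelFamEdgeMomentsBeyondDiagonalDiagPolyWeight
import HarnessLib

/-!
# Route `PrimeLevelFamEdge`, crux K_A `MomentsBeyondDiagonal` (stmt-Parity-20007), line «petersson_layers» v4, stub `stub_diag`:
# **the `L`-term of the general-profile kernel form: `Σ_{n≤M} φ(n)W(n)²(L+κ(n))𝒮_n² = ζ(2)²·L·∫₀¹P″²/log³M + O(log⁻³M)`**

Census item G5/G6 (the `L`-term with its error budget) of the `stub_diag` repair census
(`Lines/petersson_layers_stub_diag_g4_bricks.md`). In Selberg coordinates the kernel form of the profile `P` is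
`Σ_n φ(n)W(n)²((L+κ(n))𝒮_n² + 2𝒮_n𝒫_n)` (`quadForm_profile_eq`). With the profile coordinate
`𝒮_n = m_n + δ_n`, `m_n = E_n P″(u_n)/log²M`, `|δ_n| ≪ D(n)(1/((1+log(M/n))²log²M) + 1/log³M)` (`…DiagProfileCoord`),
the split `(L+κ)𝒮² = L·m² + (Lδ(𝒮+m) + κ𝒮²)`, the identity `φ(n)W(n)²E_n = ζ(2)|W(n)|` (`KernelFormXSqCollapse`) and the
polynomial-weight engine `Σ|W|E·R(u_n) = ζ(2)log M∫₀¹R + O(1)` at `R = (P″)²` (`…DiagPolyWeight`):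

* `abs_LMain_sub_le` — `|L·Σ_n φW²m_n² − ζ(2)²L∫₀¹P″²/log³M| ≤ C/log³M` (`0 ≤ L ≤ log M`);
* `abs_LErr_le` — `Σ_n|φW²(Lδ_n(𝒮_n+m_n) + κ(n)𝒮_n²)| ≤ C/log³M` (dyadic sum, `ΣD²/n`, `ΣκD²/n` of `KernelFormXSqSums/B`);
* `abs_LTerm_sub_le` — **`|Σ_{n≤M}φ(n)W(n)²(L+κ(n))𝒮_n² − ζ(2)²·L·∫₀¹P″(u)²du/log³M| ≤ C_P/log³M`** for `M ≥ 3`,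
  `0 ≤ L ≤ log M`, `P₀ = P₁ = 0`. At `P = X²` this is the slope constant `4ζ(2)²L/log³M` of `kernelForm_xsq_asymp`.

Def-free; theorems only. Helper `--supports stmt-Parity-20007`; closes nothing; K_A, K_B and the Parity summit are
NOT proved; nothing about Landau–Siegel zeros.

## References
* E. Kowalski, P. Michel, J. VanderKam, J. reine angew. Math. 526 (2000), Prop. 5.1 (31) p. 18 (the term
  `ζ(2)²Δ⁻¹∫₀¹P″²` of the second moment). [cite: KowalskiMichelVanderKam2000, Prop. 5.1 — derivation]
-/

noncomputable section

open scoped Real ArithmeticFunction.Moebius ArithmeticFunction.sigma ArithmeticFunction.zeta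
open Finset ArithmeticFunction Polynomial MeasureTheory intervalIntegral

namespace Summit.Parity.GeneralizedHardyLittlewood.Theorems.MomentsBeyondDiagonal.DiagKernel

open Literature.NumberTheory.LFunctions Literature.NumberTheory.LFunctions.KMV2000
open MollifierMainTerm (W)
open SelbergCoord (kappa)
open Literature.NumberTheory.Sieve (one_le_log_of_three_le)
open Summit.Parity.GeneralizedHardyLittlewood.Theorems.BeyondDiagonalBeatsQuarter.KernelFormXSq
  (copTauW mainConst divWeight divWeight_nonneg mainConst_nonneg mainConst_le_divWeight
    totient_mul_W_sq_mul_mainConst totient_mul_W_sq_le sum_divWeight_sq_div_le sum_divWeight_sq_dyadic_le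
    sum_kappa_divWeight_sq_div_le)

/-! ### The main part `L·Σ φW²m_n²` -/

/-- **The `L`-main part**: with `m_n = E_n·P″(log(M/n)/log M)/log²M`,
`|L·Σ_{n≤M}φ(n)W(n)²m_n² − ζ(2)²·L·∫₀¹P″²/log³M| ≤ C/log³M` for `M ≥ 3`, `0 ≤ L ≤ log M`
(`φW²E² = ζ(2)|W|E`, polynomial weight `(P″)²`). [cite: KowalskiMichelVanderKam2000, Prop. 5.1 — derivation] -/
theorem abs_LMain_sub_le (P : ℝ[X]) :
    ∃ C : ℝ, 0 < C ∧ ∀ M : ℝ, 3 ≤ M → ∀ L : ℝ, 0 ≤ L → L ≤ Real.log M →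
      |L * ∑ n ∈ Icc 1 ⌊M⌋₊, (Nat.totient n : ℝ) * W n ^ 2 *
          (mainConst n * ((derivative (derivative P)).eval (Real.log (M / n) / Real.log M) / Real.log M ^ 2)) ^ 2 -
        (π ^ 2 / 6) ^ 2 * L * (∫ u in (0 : ℝ)..1, ((derivative (derivative P)).eval u) ^ 2) / Real.log M ^ 3| ≤
        C / Real.log M ^ 3 := by
  set Q := derivative (derivative P) with hQ
  obtain ⟨C₄, hC₄, h4⟩ := abs_sum_absW_mainConst_mul_eval_sub_integral_le (Q * Q)
  refine ⟨π ^ 2 / 6 * C₄ + 1, by positivity, fun M hM L hL0 hLℓ ↦ ?_⟩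
  set ℓ := Real.log M with hℓ
  have hℓ1 : 1 ≤ ℓ := one_le_log_of_three_le hM
  have hℓ0 : 0 < ℓ := by linarith
  -- `φW²m² = ζ(2)|W|E·Q(u)²/ℓ⁴`
  have hmain : ∑ n ∈ Icc 1 ⌊M⌋₊, (Nat.totient n : ℝ) * W n ^ 2 *
      (mainConst n * (Q.eval (Real.log (M / n) / ℓ) / ℓ ^ 2)) ^ 2 =
      π ^ 2 / 6 / ℓ ^ 4 * ∑ n ∈ Icc 1 ⌊M⌋₊, |W n| * mainConst n * (Q * Q).eval (Real.log (M / n) / ℓ) := by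
    rw [Finset.mul_sum]
    refine Finset.sum_congr rfl fun n hn ↦ ?_
    have hn0 : n ≠ 0 := by have := (Finset.mem_Icc.1 hn).1; omega
    have h := totient_mul_W_sq_mul_mainConst hn0
    rw [Polynomial.eval_mul]
    calc (Nat.totient n : ℝ) * W n ^ 2 * (mainConst n * (Q.eval (Real.log (M / n) / ℓ) / ℓ ^ 2)) ^ 2
        = ((Nat.totient n : ℝ) * W n ^ 2 * mainConst n) * mainConst n *
            (Q.eval (Real.log (M / n) / ℓ)) ^ 2 / ℓ ^ 4 := by ring
      _ = π ^ 2 / 6 / ℓ ^ 4 * (|W n| * mainConst n *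
            (Q.eval (Real.log (M / n) / ℓ) * Q.eval (Real.log (M / n) / ℓ))) := by rw [h]; ring
  have hI := h4 M hM
  rw [hmain]
  have key : L * (π ^ 2 / 6 / ℓ ^ 4 * ∑ n ∈ Icc 1 ⌊M⌋₊, |W n| * mainConst n * (Q * Q).eval (Real.log (M / n) / ℓ)) -
      (π ^ 2 / 6) ^ 2 * L * (∫ u in (0 : ℝ)..1, (Q.eval u) ^ 2) / ℓ ^ 3 =
      L * (π ^ 2 / 6) / ℓ ^ 4 * (∑ n ∈ Icc 1 ⌊M⌋₊, |W n| * mainConst n * (Q * Q).eval (Real.log (M / n) / ℓ) -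
        π ^ 2 / 6 * ℓ * ∫ u in (0 : ℝ)..1, (Q * Q).eval u) := by
    have he : (∫ u in (0 : ℝ)..1, (Q * Q).eval u) = ∫ u in (0 : ℝ)..1, (Q.eval u) ^ 2 :=
      intervalIntegral.integral_congr fun u _ ↦ by simp [Polynomial.eval_mul, sq]
    rw [he]
    field_simp
  rw [key, abs_mul, abs_of_nonneg (by positivity : (0 : ℝ) ≤ L * (π ^ 2 / 6) / ℓ ^ 4)]
  calc L * (π ^ 2 / 6) / ℓ ^ 4 * |∑ n ∈ Icc 1 ⌊M⌋₊, |W n| * mainConst n * (Q * Q).eval (Real.log (M / n) / ℓ) -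
          π ^ 2 / 6 * ℓ * ∫ u in (0 : ℝ)..1, (Q * Q).eval u|
      ≤ ℓ * (π ^ 2 / 6) / ℓ ^ 4 * C₄ := by gcongr
    _ = π ^ 2 / 6 * C₄ / ℓ ^ 3 := by field_simp
    _ ≤ (π ^ 2 / 6 * C₄ + 1) / ℓ ^ 3 := by gcongr; linarith

/-! ### The error part `Σ φW²(Lδ(𝒮+m) + κ𝒮²)` -/

/-- **The `L`-error part**: for `P` with `P₀ = P₁ = 0`, `M ≥ 3`, `0 ≤ L ≤ log M`, with `𝒮_n` the profile coordinate and
`m_n = E_n P″(u_n)/log²M`: `Σ_{n≤M}|φ(n)W(n)²(L(𝒮_n − m_n)(𝒮_n + m_n) + κ(n)𝒮_n²)| ≤ C/log³M`.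
[cite: KowalskiMichelVanderKam2000, Prop. 5.1 — derivation (error bookkeeping)] -/
theorem abs_LErr_le (P : ℝ[X]) (hP0 : P.coeff 0 = 0) (hP1 : P.coeff 1 = 0) :
    ∃ C : ℝ, 0 < C ∧ ∀ M : ℝ, 3 ≤ M → ∀ L : ℝ, 0 ≤ L → L ≤ Real.log M →
      ∑ n ∈ Icc 1 ⌊M⌋₊, |(Nat.totient n : ℝ) * W n ^ 2 *
          (L * ((∑ c ∈ Finset.range (P.natDegree + 1), P.coeff c *
                ((∑ k ∈ Icc 1 ⌊M / n⌋₊, copTauW n k * Real.log (M / n / k) ^ c) / Real.log M ^ c)) -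
              mainConst n * ((derivative (derivative P)).eval (Real.log (M / n) / Real.log M) / Real.log M ^ 2)) *
            ((∑ c ∈ Finset.range (P.natDegree + 1), P.coeff c *
                ((∑ k ∈ Icc 1 ⌊M / n⌋₊, copTauW n k * Real.log (M / n / k) ^ c) / Real.log M ^ c)) +
              mainConst n * ((derivative (derivative P)).eval (Real.log (M / n) / Real.log M) / Real.log M ^ 2)) +
          kappa n * (∑ c ∈ Finset.range (P.natDegree + 1), P.coeff c *
                ((∑ k ∈ Icc 1 ⌊M / n⌋₊, copTauW n k * Real.log (M / n / k) ^ c) / Real.log M ^ c)) ^ 2)| ≤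
        C / Real.log M ^ 3 := by
  obtain ⟨C₁, hC₁, h1⟩ := abs_profileCoord_sub_derivative2_le P hP0 hP1
  obtain ⟨C₂, hC₂, h2⟩ := abs_profileCoord_le P hP0 hP1
  obtain ⟨C₃, hC₃, h3⟩ := abs_profileMain_le P
  obtain ⟨C_E, hC_E, hE⟩ := mainConst_le_divWeight
  set Z : ℝ := (∑' d : ℕ, (d : ℝ) ^ (-(5 / 4 : ℝ))) ^ 2 with hZ
  refine ⟨C₁ * (C₂ + C₃ * C_E) * (8 * Z + 3 * Z) + C₂ ^ 2 * (48 * Z * 3) + 1, by positivity,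
    fun M hM L hL0 hLℓ ↦ ?_⟩
  set ℓ := Real.log M with hℓ
  have hℓ1 : 1 ≤ ℓ := one_le_log_of_three_le hM
  have hℓ0 : 0 < ℓ := by linarith
  have hM0 : 0 < M := by linarith
  have hM1 : (1 : ℝ) ≤ M := by linarith
  set N := ⌊M⌋₊ with hN
  have hN1 : 1 ≤ N := Nat.le_floor (by simpa using hM1)
  have hNM : (N : ℝ) ≤ M := Nat.floor_le hM0.le
  have hlogN : Real.log N ≤ ℓ := Real.log_le_log (by exact_mod_cast hN1) hNM
  set Q := derivative (derivative P) with hQ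
  -- pointwise bound
  have hterm : ∀ n ∈ Icc 1 N, |(Nat.totient n : ℝ) * W n ^ 2 *
      (L * ((∑ c ∈ Finset.range (P.natDegree + 1), P.coeff c *
            ((∑ k ∈ Icc 1 ⌊M / n⌋₊, copTauW n k * Real.log (M / n / k) ^ c) / ℓ ^ c)) -
          mainConst n * (Q.eval (Real.log (M / n) / ℓ) / ℓ ^ 2)) *
        ((∑ c ∈ Finset.range (P.natDegree + 1), P.coeff c *
            ((∑ k ∈ Icc 1 ⌊M / n⌋₊, copTauW n k * Real.log (M / n / k) ^ c) / ℓ ^ c)) +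
          mainConst n * (Q.eval (Real.log (M / n) / ℓ) / ℓ ^ 2)) +
      kappa n * (∑ c ∈ Finset.range (P.natDegree + 1), P.coeff c *
            ((∑ k ∈ Icc 1 ⌊M / n⌋₊, copTauW n k * Real.log (M / n / k) ^ c) / ℓ ^ c)) ^ 2)| ≤
      L * (C₁ * (C₂ + C₃ * C_E)) * (divWeight n ^ 2 / (n * (1 + Real.log (M / n)) ^ 2) / ℓ ^ 4 +
        divWeight n ^ 2 / n / ℓ ^ 5) + C₂ ^ 2 * (kappa n * divWeight n ^ 2 / n) / ℓ ^ 4 := by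
    intro n hn
    have hn' := Finset.mem_Icc.1 hn
    have hn0 : n ≠ 0 := by omega
    have hn0' : (0 : ℝ) < n := by exact_mod_cast hn'.1
    have hnM : (n : ℝ) ≤ M := le_trans (by exact_mod_cast hn'.2) hNM
    set s := ∑ c ∈ Finset.range (P.natDegree + 1), P.coeff c *
      ((∑ k ∈ Icc 1 ⌊M / n⌋₊, copTauW n k * Real.log (M / n / k) ^ c) / ℓ ^ c) with hs
    set m := mainConst n * (Q.eval (Real.log (M / n) / ℓ) / ℓ ^ 2) with hm
    set y := Real.log (M / n) with hy
    have hy0 : 0 ≤ y := (log_div_nonneg_and_le hM hn0 hnM).1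
    have hδ : |s - m| ≤ C₁ * divWeight n * (1 / ((1 + y) ^ 2 * ℓ ^ 2) + 1 / ℓ ^ 3) := h1 M hM n hn0 hnM
    have hsb : |s| ≤ C₂ * divWeight n / ℓ ^ 2 := h2 M hM n hn0 hnM
    have hmb : |m| ≤ C₃ * C_E * divWeight n / ℓ ^ 2 := by
      have h := h3 M hM n hn0 hnM
      rw [sum_coeff_mul_desc_eq_derivative2_eval P hℓ0.ne'] at h
      calc |m| ≤ C₃ * mainConst n / ℓ ^ 2 := h
        _ ≤ C₃ * (C_E * divWeight n) / ℓ ^ 2 := by gcongr; exact hE n hn0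
        _ = C₃ * C_E * divWeight n / ℓ ^ 2 := by ring
    have hc := totient_mul_W_sq_le n
    have hc0 : 0 ≤ (Nat.totient n : ℝ) * W n ^ 2 := by positivity
    have hD := divWeight_nonneg n
    have hκ : 0 ≤ kappa n := by
      unfold kappa
      exact Finset.sum_nonneg fun p hp ↦ by
        have hp2 : (2 : ℝ) ≤ p := by exact_mod_cast (Nat.prime_of_mem_primeFactors hp).two_le
        exact div_nonneg (Real.log_nonneg (by linarith)) (by linarith)
    have hspm : |s + m| ≤ (C₂ + C₃ * C_E) * divWeight n / ℓ ^ 2 := by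
      calc |s + m| ≤ |s| + |m| := abs_add_le _ _
        _ ≤ C₂ * divWeight n / ℓ ^ 2 + C₃ * C_E * divWeight n / ℓ ^ 2 := add_le_add hsb hmb
        _ = (C₂ + C₃ * C_E) * divWeight n / ℓ ^ 2 := by ring
    rw [abs_mul, abs_of_nonneg hc0]
    have hin : |L * (s - m) * (s + m) + kappa n * s ^ 2| ≤
        L * (C₁ * divWeight n * (1 / ((1 + y) ^ 2 * ℓ ^ 2) + 1 / ℓ ^ 3)) * ((C₂ + C₃ * C_E) * divWeight n / ℓ ^ 2) +
          kappa n * (C₂ * divWeight n / ℓ ^ 2) ^ 2 := by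
      calc |L * (s - m) * (s + m) + kappa n * s ^ 2|
          ≤ |L * (s - m) * (s + m)| + |kappa n * s ^ 2| := abs_add_le _ _
        _ = L * |s - m| * |s + m| + kappa n * |s| ^ 2 := by
            rw [abs_mul, abs_mul, abs_of_nonneg hL0, abs_mul, abs_of_nonneg hκ, abs_pow]
        _ ≤ L * (C₁ * divWeight n * (1 / ((1 + y) ^ 2 * ℓ ^ 2) + 1 / ℓ ^ 3)) *
              ((C₂ + C₃ * C_E) * divWeight n / ℓ ^ 2) + kappa n * (C₂ * divWeight n / ℓ ^ 2) ^ 2 := by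
            gcongr
    calc (Nat.totient n : ℝ) * W n ^ 2 * |L * (s - m) * (s + m) + kappa n * s ^ 2|
        ≤ (n : ℝ)⁻¹ * (L * (C₁ * divWeight n * (1 / ((1 + y) ^ 2 * ℓ ^ 2) + 1 / ℓ ^ 3)) *
            ((C₂ + C₃ * C_E) * divWeight n / ℓ ^ 2) + kappa n * (C₂ * divWeight n / ℓ ^ 2) ^ 2) :=
          mul_le_mul hc hin (abs_nonneg _) (by positivity)
      _ = L * (C₁ * (C₂ + C₃ * C_E)) * (divWeight n ^ 2 / (n * (1 + y) ^ 2) / ℓ ^ 4 +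
            divWeight n ^ 2 / n / ℓ ^ 5) + C₂ ^ 2 * (kappa n * divWeight n ^ 2 / n) / ℓ ^ 4 := by
          field_simp
  -- sum the pointwise bound
  have hS1 := sum_divWeight_sq_dyadic_le hM1
  have hS2 := sum_divWeight_sq_div_le hN1
  have hS3 := sum_kappa_divWeight_sq_div_le hN1
  rw [← hZ, ← hN] at hS1
  rw [← hZ] at hS2 hS3
  have hZ0 : 0 ≤ Z := sq_nonneg _
  have hlogN0 : 0 ≤ Real.log N := Real.log_nonneg (by exact_mod_cast hN1)
  refine (Finset.sum_le_sum hterm).trans ?_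
  rw [Finset.sum_add_distrib, ← Finset.mul_sum, ← Finset.sum_div, ← Finset.mul_sum, Finset.sum_add_distrib,
    ← Finset.sum_div, ← Finset.sum_div]
  have hA : (∑ n ∈ Icc 1 N, divWeight n ^ 2 / (n * (1 + Real.log (M / n)) ^ 2)) / ℓ ^ 4 ≤ 8 * Z / ℓ ^ 4 := by
    gcongr
  have hB : (∑ n ∈ Icc 1 N, divWeight n ^ 2 / n) / ℓ ^ 5 ≤ 3 * Z / ℓ ^ 4 := by
    rw [div_le_div_iff₀ (by positivity) (by positivity)]
    calc (∑ n ∈ Icc 1 N, divWeight n ^ 2 / n) * ℓ ^ 4 ≤ Z * (2 + Real.log N) * ℓ ^ 4 := by gcongr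
      _ ≤ Z * (3 * ℓ) * ℓ ^ 4 := by gcongr; linarith
      _ = 3 * Z * ℓ ^ 5 := by ring
  have hC : (∑ n ∈ Icc 1 N, kappa n * divWeight n ^ 2 / n) / ℓ ^ 4 ≤ 48 * Z * 3 / ℓ ^ 3 := by
    rw [div_le_div_iff₀ (by positivity) (by positivity)]
    calc (∑ n ∈ Icc 1 N, kappa n * divWeight n ^ 2 / n) * ℓ ^ 3 ≤ 48 * Z * (2 + Real.log N) * ℓ ^ 3 := by gcongr
      _ ≤ 48 * Z * (3 * ℓ) * ℓ ^ 3 := by gcongr; linarith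
      _ = 48 * Z * 3 * ℓ ^ 4 := by ring
  have hK0 : 0 ≤ C₁ * (C₂ + C₃ * C_E) := by positivity
  calc L * (C₁ * (C₂ + C₃ * C_E)) *
        ((∑ n ∈ Icc 1 N, divWeight n ^ 2 / (n * (1 + Real.log (M / n)) ^ 2)) / ℓ ^ 4 +
          (∑ n ∈ Icc 1 N, divWeight n ^ 2 / n) / ℓ ^ 5) +
        C₂ ^ 2 * (∑ n ∈ Icc 1 N, kappa n * divWeight n ^ 2 / n) / ℓ ^ 4
      ≤ ℓ * (C₁ * (C₂ + C₃ * C_E)) * (8 * Z / ℓ ^ 4 + 3 * Z / ℓ ^ 4) + C₂ ^ 2 * (48 * Z * 3 / ℓ ^ 3) := by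
        rw [mul_div_assoc]
        gcongr
    _ = (C₁ * (C₂ + C₃ * C_E) * (8 * Z + 3 * Z) + C₂ ^ 2 * (48 * Z * 3)) / ℓ ^ 3 := by
        field_simp
    _ ≤ (C₁ * (C₂ + C₃ * C_E) * (8 * Z + 3 * Z) + C₂ ^ 2 * (48 * Z * 3) + 1) / ℓ ^ 3 :=
        div_le_div_of_nonneg_right (by linarith) (by positivity)

/-! ### The `L`-term -/

/-- **The `L`-term of the general-profile kernel form.** For a real polynomial `P` with `P₀ = P₁ = 0` there is `C_P`
such that for all `M ≥ 3` and `0 ≤ L ≤ log M`, with `𝒮_n = Σ_c P_c S⁽ᶜ⁾(M/n;n)/logᶜM` the profile coordinate,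
`|Σ_{n≤M} φ(n)W(n)²(L+κ(n))𝒮_n² − ζ(2)²·L·∫₀¹P″(u)²du/log³M| ≤ C_P/log³M`.
[cite: KowalskiMichelVanderKam2000, Prop. 5.1 — derivation (the term `ζ(2)²Δ⁻¹∫₀¹P″²` of (31), general profile)] -/
theorem abs_LTerm_sub_le (P : ℝ[X]) (hP0 : P.coeff 0 = 0) (hP1 : P.coeff 1 = 0) :
    ∃ C : ℝ, 0 < C ∧ ∀ M : ℝ, 3 ≤ M → ∀ L : ℝ, 0 ≤ L → L ≤ Real.log M →
      |∑ n ∈ Icc 1 ⌊M⌋₊, (Nat.totient n : ℝ) * W n ^ 2 *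
          ((L + kappa n) * (∑ c ∈ Finset.range (P.natDegree + 1), P.coeff c *
              ((∑ k ∈ Icc 1 ⌊M / n⌋₊, copTauW n k * Real.log (M / n / k) ^ c) / Real.log M ^ c)) ^ 2) -
        (π ^ 2 / 6) ^ 2 * L * (∫ u in (0 : ℝ)..1, ((derivative (derivative P)).eval u) ^ 2) / Real.log M ^ 3| ≤
        C / Real.log M ^ 3 := by
  obtain ⟨C₁, hC₁, h1⟩ := abs_LMain_sub_le P
  obtain ⟨C₂, hC₂, h2⟩ := abs_LErr_le P hP0 hP1
  refine ⟨C₁ + C₂, by positivity, fun M hM L hL0 hLℓ ↦ ?_⟩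
  set ℓ := Real.log M with hℓ
  have hℓ1 : 1 ≤ ℓ := one_le_log_of_three_le hM
  have hℓ0 : 0 < ℓ := by linarith
  set Q := derivative (derivative P) with hQ
  set N := ⌊M⌋₊ with hN
  -- the pointwise split `(L+κ)s² = L m² + (L(s−m)(s+m) + κ s²)`
  have hsplit : ∀ n ∈ Icc 1 N, (Nat.totient n : ℝ) * W n ^ 2 *
      ((L + kappa n) * (∑ c ∈ Finset.range (P.natDegree + 1), P.coeff c *
          ((∑ k ∈ Icc 1 ⌊M / n⌋₊, copTauW n k * Real.log (M / n / k) ^ c) / ℓ ^ c)) ^ 2) =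
      L * ((Nat.totient n : ℝ) * W n ^ 2 * (mainConst n * (Q.eval (Real.log (M / n) / ℓ) / ℓ ^ 2)) ^ 2) +
      (Nat.totient n : ℝ) * W n ^ 2 *
        (L * ((∑ c ∈ Finset.range (P.natDegree + 1), P.coeff c *
              ((∑ k ∈ Icc 1 ⌊M / n⌋₊, copTauW n k * Real.log (M / n / k) ^ c) / ℓ ^ c)) -
            mainConst n * (Q.eval (Real.log (M / n) / ℓ) / ℓ ^ 2)) *
          ((∑ c ∈ Finset.range (P.natDegree + 1), P.coeff c *
              ((∑ k ∈ Icc 1 ⌊M / n⌋₊, copTauW n k * Real.log (M / n / k) ^ c) / ℓ ^ c)) +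
            mainConst n * (Q.eval (Real.log (M / n) / ℓ) / ℓ ^ 2)) +
        kappa n * (∑ c ∈ Finset.range (P.natDegree + 1), P.coeff c *
              ((∑ k ∈ Icc 1 ⌊M / n⌋₊, copTauW n k * Real.log (M / n / k) ^ c) / ℓ ^ c)) ^ 2) := by
    intro n _
    ring
  rw [Finset.sum_congr rfl hsplit, Finset.sum_add_distrib, ← Finset.mul_sum]
  have hA := h1 M hM L hL0 hLℓ
  have hB := h2 M hM L hL0 hLℓ
  simp only [← hℓ, ← hN] at hA hB
  calc _ ≤ |L * ∑ n ∈ Icc 1 N, (Nat.totient n : ℝ) * W n ^ 2 *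
            (mainConst n * (Q.eval (Real.log (M / n) / ℓ) / ℓ ^ 2)) ^ 2 -
          (π ^ 2 / 6) ^ 2 * L * (∫ u in (0 : ℝ)..1, (Q.eval u) ^ 2) / ℓ ^ 3| +
        |∑ n ∈ Icc 1 N, (Nat.totient n : ℝ) * W n ^ 2 *
          (L * ((∑ c ∈ Finset.range (P.natDegree + 1), P.coeff c *
                ((∑ k ∈ Icc 1 ⌊M / n⌋₊, copTauW n k * Real.log (M / n / k) ^ c) / ℓ ^ c)) -
              mainConst n * (Q.eval (Real.log (M / n) / ℓ) / ℓ ^ 2)) *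
            ((∑ c ∈ Finset.range (P.natDegree + 1), P.coeff c *
                ((∑ k ∈ Icc 1 ⌊M / n⌋₊, copTauW n k * Real.log (M / n / k) ^ c) / ℓ ^ c)) +
              mainConst n * (Q.eval (Real.log (M / n) / ℓ) / ℓ ^ 2)) +
          kappa n * (∑ c ∈ Finset.range (P.natDegree + 1), P.coeff c *
                ((∑ k ∈ Icc 1 ⌊M / n⌋₊, copTauW n k * Real.log (M / n / k) ^ c) / ℓ ^ c)) ^ 2)| := by
        rw [show ∀ a b c : ℝ, a + b - c = (a - c) + b from fun a b c ↦ by ring]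
        exact abs_add_le _ _
    _ ≤ C₁ / ℓ ^ 3 + C₂ / ℓ ^ 3 := add_le_add hA ((Finset.abs_sum_le_sum_abs _ _).trans hB)
    _ = (C₁ + C₂) / ℓ ^ 3 := by ring

end Summit.Parity.GeneralizedHardyLittlewood.Theorems.MomentsBeyondDiagonal.DiagKernel

end
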